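import Summits.CriticalPhenomena.SAWScalingLimit.Theorems.SAWTotalPositivityBoundaryTP2Defs
import Summits.CriticalPhenomena.SAWScalingLimit.Theorems.SAWTotalPositivityBoundaryTP2Kernel
import Summits.CriticalPhenomena.SAWScalingLimit.Theorems.SAWTotalPositivityBoundaryTP2Symmetry
import Summits.CriticalPhenomena.SAWScalingLimit.Theorems.SAWTotalPositivityBoundaryTP2FirstStep
import Summits.CriticalPhenomena.SAWScalingLimit.Theorems.SAWTotalPositivityBoundaryTP2Avoid
import Summits.CriticalPhenomena.SAWScalingLimit.Theorems.SAWTotalPositivityBoundaryTP2SquareGadget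
import Summits.CriticalPhenomena.SAWScalingLimit.Theorems.SAWTotalPositivityBoundaryTP2CutVertex
import Summits.CriticalPhenomena.SAWScalingLimit.Theorems.SAWTotalPositivityBoundaryTP2RectReflect
import Summits.CriticalPhenomena.SAWScalingLimit.Theorems.EdgeOfPositivity.Negative.EdgeOfPositivityRectDomain
import HarnessLib

/-!
# Crux `BoundaryTP2` (stmt-CriticalPhenomena-7115), line `Sketch`: the rung kernels of the ladders

Tool stub `stub_ladderRung` of the line's skeleton: on the ladder
`R_L = discreteDomainGraph (rectDomain L 1) 1` (sites `{0..L} × {0,1}`, lattice adjacency) the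
fugacity-`x` self-avoiding path kernel between the two sites `(i,0)`, `(i,1)` of the column `i ≤ L` is

  `Z_{R_L}((i,0),(i,1)) = x + E_i + E_{L-i}`,   `E_k = Σ_{d<k} x^{2d+3}`,

for every `L`, every `i ≤ L` and every `x ≥ 0`: a self-avoiding path from `(i,0)` to `(i,1)` is the
rung itself, or a U-turn excursion to the left (along row `0` to column `i-d-1`, up, and back along
row `1`; weight `x^{2(d+1)+1}`, `d < i`), or the mirror excursion to the right (`d < L-i`).

Proof.
* End rung (`i = L`): first step at the corner `(L,0)` (neighbours `(L,1)`, `(L-1,0)`); in `R_L - (L,0)`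
  the target `(L,1)` is a leaf hanging on `(L-1,1)`, and deleting the whole last column leaves `R_{L-1}`:
  `Z_L = x (1 + x Z_{L-1})`, `Z_0 = x`, whence `Z_L = x + E_L`.
* `i = 0`: the reflection `(u₀,u₁) ↦ (L-u₀,u₁)` is an automorphism of `R_L` (path kernels are
  invariant under graph isomorphisms: `pathKernel_map_iso`, `exists_iso_rect_reflect_fst`).
* `0 < i < L`: first step at `a = (i,0)` (three neighbours `(i-1,0)`, `(i,1)`, `(i+1,0)`). In `R_L - a`
  the target `c = (i,1)` is a cut vertex between the columns `< i` (plus `c`) and the columns `≥ i`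
  (`stub_cutVertex_factor` with the target as cut vertex), so the paths from `(i-1,0)` live in the left
  block, where `c` is a leaf on `(i-1,1)` and the block minus `c` is `R_{i-1}` (end rung: `x · Z_{i-1}`);
  symmetrically the paths from `(i+1,0)` live in the right block, whose complement of `c` is the ladder on
  the columns `i+1..L`, isomorphic to `R_{L-i-1}` by the reflection above. Total
  `x (x Z_{i-1} + 1 + x Z_{L-i-1}) = x + E_i + E_{L-i}`.
All graph identities are checked in coordinates (`omega`).
-/

noncomputable section

namespace Summit.CriticalPhenomena.SAWScalingLimit.Theorems.BoundaryTP2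

open Literature.Probability.LatticeModels Literature.Probability.RandomPlanarGeometry
open Summit.CriticalPhenomena.SAWScalingLimit.Theorems.EdgeOfPositivity.Negative
open scoped ENNReal

/-! ## Generic tools: induced pieces, first step at a vertex of degree three -/

section Generic

variable {V : Type*}

/-- Adjacency in the piece of `H` induced on a vertex set `S` (as a graph on all of `V`). [folklore] -/
private theorem rung_adj_fromRel (H : SimpleGraph V) (S : Set V) (u v : V) :
    (SimpleGraph.fromRel fun u v => H.Adj u v ∧ u ∈ S ∧ v ∈ S).Adj u v ↔
      H.Adj u v ∧ u ∈ S ∧ v ∈ S := by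
  -- adapted from …BoundaryTP2CutVertex (`adj_fromRel_and`)
  rw [SimpleGraph.fromRel_adj]
  constructor
  · rintro ⟨-, ⟨h, hu, hv⟩ | ⟨h, hv, hu⟩⟩
    · exact ⟨h, hu, hv⟩
    · exact ⟨h.symm, hu, hv⟩
  · rintro ⟨h, hu, hv⟩
    exact ⟨h.ne, Or.inl ⟨h, hu, hv⟩⟩

/-- **First step at a vertex with exactly three neighbours.** If `N_H(a) = {v₁, v₂, v₃}` (pairwise
distinct) and `a ≠ b`, then `Z_H(a,b) = x · (Z_{H-a}(v₁,b) + Z_{H-a}(v₂,b) + Z_{H-a}(v₃,b))` (`0 ≤ x`).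
[folklore] -/
private theorem rung_firstStep_triple [DecidableEq V] (H : SimpleGraph V) (x : ℝ) (hx : 0 ≤ x)
    {a b v₁ v₂ v₃ : V} (hab : a ≠ b) (h₁₂ : v₁ ≠ v₂) (h₁₃ : v₁ ≠ v₃) (h₂₃ : v₂ ≠ v₃)
    (hN : H.neighborSet a = {v₁, v₂, v₃}) :
    pathKernel H x a b = ENNReal.ofReal x *
      (pathKernel (H.deleteEdges (H.incidenceSet a)) x v₁ b +
        pathKernel (H.deleteEdges (H.incidenceSet a)) x v₂ b +
          pathKernel (H.deleteEdges (H.incidenceSet a)) x v₃ b) := by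
  -- adapted from …BoundaryTP2SquareGadget (`pathKernel_firstStep_pair`)
  have h₁ : H.Adj a v₁ := by rw [← SimpleGraph.mem_neighborSet, hN]; exact Set.mem_insert _ _
  have h₂ : H.Adj a v₂ := by
    rw [← SimpleGraph.mem_neighborSet, hN]; exact Set.mem_insert_of_mem _ (Set.mem_insert _ _)
  have h₃ : H.Adj a v₃ := by
    rw [← SimpleGraph.mem_neighborSet, hN]
    exact Set.mem_insert_of_mem _ (Set.mem_insert_of_mem _ (Set.mem_singleton _))
  rw [stub_pathKernel_firstStep H x hx a b hab]
  congr 1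
  set f : V → ℝ≥0∞ := fun u => pathKernelOn H x u b {γ | a ∉ γ.1.support} with hf
  have hcoe : H.neighborSet a = ((({v₁, v₂, v₃} : Finset V) : Set V)) := by
    rw [hN, Finset.coe_insert, Finset.coe_pair]
  have hni : v₁ ∉ ({v₂, v₃} : Finset V) := by
    rw [Finset.mem_insert, Finset.mem_singleton, not_or]; exact ⟨h₁₂, h₁₃⟩
  calc ∑' u : H.neighborSet a, pathKernelOn H x u b {γ | a ∉ γ.1.support}
      = ∑' u : H.neighborSet a, f u := rfl
    _ = ∑' u : ((({v₁, v₂, v₃} : Finset V) : Set V)), f u := tsum_congr_set_coe f hcoe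
    _ = ∑ u ∈ ({v₁, v₂, v₃} : Finset V), f u := Finset.tsum_subtype' _ f
    _ = f v₁ + (f v₂ + f v₃) := by rw [Finset.sum_insert hni, Finset.sum_pair h₂₃]
    _ = _ := by
        simp only [hf]
        rw [stub_pathKernelOn_avoid H x v₁ b a h₁.ne.symm hab.symm,
          stub_pathKernelOn_avoid H x v₂ b a h₂.ne.symm hab.symm,
          stub_pathKernelOn_avoid H x v₃ b a h₃.ne.symm hab.symm, add_assoc]

end Generic

/-! ## Coordinates on the ladders -/

local notation3 (prettyPrint := false) "Lad[" n "]" => discreteDomainGraph (rectDomain n 1) 1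
local notation3 (prettyPrint := false) "Del[" G ", " w "]" =>
  SimpleGraph.deleteEdges G (SimpleGraph.incidenceSet G w)
local notation3 (prettyPrint := false) "Blk[" G ", " S "]" =>
  SimpleGraph.fromRel fun u v => SimpleGraph.Adj G u v ∧ u ∈ S ∧ v ∈ S

/-- Adjacency in `ℤ²` in coordinates: the sites agree in one coordinate and differ by `1` in the
other. [folklore] -/
private theorem rung_zd_adj_iff (u v : Site 2) :
    (zdGraph 2).Adj u v ↔
      ((v 0 = u 0 + 1 ∨ u 0 = v 0 + 1) ∧ v 1 = u 1) ∨
        ((v 1 = u 1 + 1 ∨ u 1 = v 1 + 1) ∧ v 0 = u 0) := by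
  -- adapted from …BoundaryTP2LadderKernels (`ladder_zd_adj_iff`)
  rw [zdGraph_adj_iff, Fin.exists_fin_two]
  simp only [funext_iff, Fin.forall_fin_two, Pi.add_apply, Pi.single_eq_same,
    Pi.single_eq_of_ne (one_ne_zero : (1 : Fin 2) ≠ 0),
    Pi.single_eq_of_ne (zero_ne_one : (0 : Fin 2) ≠ 1), add_zero]
  omega

/-- A site equals `st a b` iff its two coordinates are `a` and `b`. [folklore] -/
private theorem rung_eq_st_iff (v : Site 2) (a b : ℤ) : v = st a b ↔ v 0 = a ∧ v 1 = b := by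
  constructor
  · rintro rfl
    exact ⟨rfl, rfl⟩
  · rintro ⟨h0, h1⟩
    rw [← st_eta v, h0, h1]

/-- Adjacency of the ladder `{0..a} × {0,1}` in coordinates. [folklore] -/
private theorem rung_adj_iff (a : ℕ) (u v : Site 2) :
    (Lad[a]).Adj u v ↔
      (((v 0 = u 0 + 1 ∨ u 0 = v 0 + 1) ∧ v 1 = u 1) ∨
          ((v 1 = u 1 + 1 ∨ u 1 = v 1 + 1) ∧ v 0 = u 0)) ∧
        ((0 ≤ u 0 ∧ u 0 ≤ a) ∧ (0 ≤ u 1 ∧ u 1 ≤ 1)) ∧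
          ((0 ≤ v 0 ∧ v 0 ≤ a) ∧ (0 ≤ v 1 ∧ v 1 ≤ 1)) := by
  rw [adj_rect_iff, rung_zd_adj_iff, mem_rectSites_iff, mem_rectSites_iff, Nat.cast_one]

/-! ## The end rung `Z_{R_n}((n,0),(n,1)) = x + E_n` -/

/-- In `R_0` (a single rung) the only neighbour of `(0,0)` is `(0,1)`. [folklore] -/
private theorem rung_base_neighborSet : (Lad[0]).neighborSet (st 0 0) = {st 0 1} := by
  ext v
  simp only [SimpleGraph.mem_neighborSet, rung_adj_iff, Set.mem_singleton_iff, rung_eq_st_iff,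
    st_zero, st_one, Nat.cast_zero]
  omega

/-- In `R_{n+1}` the corner `(n+1,0)` has exactly the two neighbours `(n,0)` and `(n+1,1)`. [folklore] -/
private theorem rung_corner_neighborSet (n : ℕ) :
    (Lad[n + 1]).neighborSet (st (n + 1 : ℕ) 0) = {st n 0, st (n + 1 : ℕ) 1} := by
  ext v
  simp only [SimpleGraph.mem_neighborSet, rung_adj_iff, Set.mem_insert_iff, Set.mem_singleton_iff,
    rung_eq_st_iff, st_zero, st_one, Nat.cast_add, Nat.cast_one]
  omega

/-- In `R_{n+1} - (n+1,0)` the site `(n+1,1)` is a leaf hanging on `(n,1)`. [folklore] -/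
private theorem rung_hanging_neighborSet (n : ℕ) :
    (Del[Lad[n + 1], st (n + 1 : ℕ) 0]).neighborSet (st (n + 1 : ℕ) 1) = {st n 1} := by
  ext v
  simp only [SimpleGraph.mem_neighborSet, deleteEdges_incidenceSet_adj, rung_adj_iff,
    Set.mem_singleton_iff, ne_eq, rung_eq_st_iff, st_zero, st_one, Nat.cast_add, Nat.cast_one]
  omega

/-- Deleting both sites of the last column of `R_{n+1}` leaves `R_n` (as graphs on `Site 2`).
[folklore] -/
private theorem rung_delete_lastColumn (n : ℕ) :
    Del[Del[Lad[n + 1], st (n + 1 : ℕ) 0], st (n + 1 : ℕ) 1] = Lad[n] := by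
  ext u v
  simp only [deleteEdges_incidenceSet_adj, rung_adj_iff, ne_eq, rung_eq_st_iff, Nat.cast_add,
    Nat.cast_one]
  omega

/-- `E_{n+1} = x² (x + E_n)` for `E_n = Σ_{d<n} x^{2d+3}`. [folklore] -/
private theorem rung_sum_succ (x : ℝ) (n : ℕ) :
    ∑ d ∈ Finset.range (n + 1), x ^ (2 * d + 3) =
      x ^ 2 * (x + ∑ d ∈ Finset.range n, x ^ (2 * d + 3)) := by
  rw [Finset.sum_range_succ', mul_add, Finset.mul_sum]
  have h : ∀ d ∈ Finset.range n, x ^ (2 * (d + 1) + 3) = x ^ 2 * x ^ (2 * d + 3) := fun d _ => by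
    ring
  rw [Finset.sum_congr rfl h]
  ring

/-- **The end rung.** `Z_{R_n}((n,0),(n,1)) = x + Σ_{d<n} x^{2d+3}` for every `n` and `x ≥ 0`
(recursion `Z_{n+1} = x (1 + x Z_n)`, `Z_0 = x`). [folklore] -/
private theorem rung_end (n : ℕ) {x : ℝ} (hx : 0 ≤ x) :
    pathKernel (Lad[n]) x (st n 0) (st n 1) =
      ENNReal.ofReal (x + ∑ d ∈ Finset.range n, x ^ (2 * d + 3)) := by
  classical
  induction n with
  | zero =>
    have hab : st 0 0 ≠ st 0 1 := by
      rw [ne_eq, rung_eq_st_iff, st_zero, st_one]; omega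
    rw [Nat.cast_zero, pathKernel_firstStep_single _ x hx hab rung_base_neighborSet, pathKernel_self,
      mul_one, Finset.sum_range_zero, add_zero]
  | succ n ih =>
    have hE : 0 ≤ ∑ d ∈ Finset.range n, x ^ (2 * d + 3) :=
      Finset.sum_nonneg fun d _ => pow_nonneg hx _
    have hab : st (n + 1 : ℕ) 0 ≠ st (n + 1 : ℕ) 1 := by
      rw [ne_eq, rung_eq_st_iff, st_zero, st_one]; omega
    have hvv : st (n : ℤ) 0 ≠ st (n + 1 : ℕ) 1 := by
      rw [ne_eq, rung_eq_st_iff, st_zero, st_one]; omega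
    rw [pathKernel_firstStep_pair _ x hx hab hvv (rung_corner_neighborSet n), pathKernel_self,
      pathKernel_comm _ x (st (n : ℤ) 0) (st (n + 1 : ℕ) 1),
      pathKernel_firstStep_single _ x hx hvv.symm (rung_hanging_neighborSet n),
      rung_delete_lastColumn n, pathKernel_comm _ x (st (n : ℤ) 1) (st (n : ℤ) 0), ih,
      ← ENNReal.ofReal_mul hx, ← ENNReal.ofReal_one,
      ← ENNReal.ofReal_add (mul_nonneg hx (add_nonneg hx hE)) zero_le_one, ← ENNReal.ofReal_mul hx,
      rung_sum_succ]
    congr 1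
    ring

/-- The first rung equals the end rung, `Z_{R_L}((0,0),(0,1)) = Z_{R_L}((L,0),(L,1))`, by the reflection
automorphism `(u₀,u₁) ↦ (L-u₀,u₁)` of `R_L` (`exists_iso_rect_reflect_fst`, `pathKernel_map_iso`).
[folklore] -/
private theorem rung_start (L : ℕ) (x : ℝ) :
    pathKernel (Lad[L]) x (st 0 0) (st 0 1) = pathKernel (Lad[L]) x (st L 0) (st L 1) := by
  obtain ⟨φ, hφ⟩ := exists_iso_rect_reflect_fst L 1
  have h0 : φ (st L 0) = st 0 0 := by rw [hφ, st_zero, st_one, sub_self]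
  have h1 : φ (st L 1) = st 0 1 := by rw [hφ, st_zero, st_one, sub_self]
  rw [← h0, ← h1, pathKernel_map_iso φ x]

/-! ## Interior rungs: first step at `(i,0)`, cut vertex `(i,1)` of `R_L - (i,0)` -/

local notation3 (prettyPrint := false) "Aset[" k "]" =>
  {v : Site 2 | v 0 ≤ (k : ℤ) ∨ v = st ((k + 1 : ℕ) : ℤ) 1}
local notation3 (prettyPrint := false) "Bset[" k "]" => {v : Site 2 | (k : ℤ) + 1 ≤ v 0}

/-- In `R_{k+m+2}` the bottom site `(k+1,0)` of an interior column has exactly the three neighbours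
`(k,0)`, `(k+1,1)`, `(k+2,0)`. [folklore] -/
private theorem rung_mid_neighborSet (k m : ℕ) :
    (Lad[k + m + 2]).neighborSet (st (k + 1 : ℕ) 0) =
      {st k 0, st (k + 1 : ℕ) 1, st ((k : ℤ) + 2) 0} := by
  ext v
  simp only [SimpleGraph.mem_neighborSet, rung_adj_iff, Set.mem_insert_iff, Set.mem_singleton_iff,
    rung_eq_st_iff, st_zero, st_one, Nat.cast_add, Nat.cast_one, Nat.cast_ofNat]
  omega

/-- In the left block of `R_{k+m+2} - (k+1,0)` (columns `≤ k` together with `c = (k+1,1)`) the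
vertex `c` is a leaf hanging on `(k,1)`. [folklore] -/
private theorem rung_leftBlock_neighborSet (k m : ℕ) :
    (Blk[Del[Lad[k + m + 2], st (k + 1 : ℕ) 0], Aset[k]]).neighborSet (st (k + 1 : ℕ) 1) =
      {st k 1} := by
  ext v
  rw [SimpleGraph.mem_neighborSet, rung_adj_fromRel]
  simp only [deleteEdges_incidenceSet_adj, rung_adj_iff, Set.mem_setOf_eq, Set.mem_singleton_iff, ne_eq,
    rung_eq_st_iff, st_zero, st_one, Nat.cast_add, Nat.cast_one, Nat.cast_ofNat, true_and, and_true,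
    or_true]
  omega

/-- The left block minus `c = (k+1,1)` is the ladder `R_k`. [folklore] -/
private theorem rung_leftBlock_delete (k m : ℕ) :
    Del[Blk[Del[Lad[k + m + 2], st (k + 1 : ℕ) 0], Aset[k]], st (k + 1 : ℕ) 1] = Lad[k] := by
  ext u v
  rw [deleteEdges_incidenceSet_adj, rung_adj_fromRel]
  simp only [deleteEdges_incidenceSet_adj, rung_adj_iff, Set.mem_setOf_eq, ne_eq, rung_eq_st_iff,
    Nat.cast_add, Nat.cast_one, Nat.cast_ofNat]
  omega

/-- In the right block of `R_{k+m+2} - (k+1,0)` (columns `≥ k+1`) the vertex `c = (k+1,1)` is a leaf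
hanging on `(k+2,1)`. [folklore] -/
private theorem rung_rightBlock_neighborSet (k m : ℕ) :
    (Blk[Del[Lad[k + m + 2], st (k + 1 : ℕ) 0], Bset[k]]).neighborSet (st (k + 1 : ℕ) 1) =
      {st ((k : ℤ) + 2) 1} := by
  ext v
  rw [SimpleGraph.mem_neighborSet, rung_adj_fromRel]
  simp only [deleteEdges_incidenceSet_adj, rung_adj_iff, Set.mem_setOf_eq, Set.mem_singleton_iff, ne_eq,
    rung_eq_st_iff, st_zero, st_one, Nat.cast_add, Nat.cast_one, Nat.cast_ofNat, true_and]
  omega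

/-- The right block minus `c = (k+1,1)` (the ladder on the columns `k+2..k+m+2`) is isomorphic to `R_m`
by the reflection `(u₀,u₁) ↦ (k+m+2-u₀,u₁)`. [folklore] -/
private theorem rung_rightBlock_iso (k m : ℕ) :
    ∃ ψ : Del[Blk[Del[Lad[k + m + 2], st (k + 1 : ℕ) 0], Bset[k]], st (k + 1 : ℕ) 1] ≃g Lad[m],
      ∀ v, ψ v = st ((k + m + 2 : ℕ) - v 0) (v 1) := by
  have hinv : Function.Involutive (fun v : Site 2 => st ((k + m + 2 : ℕ) - v 0) (v 1)) := by
    intro v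
    simp only [st_zero, st_one, sub_sub_cancel]
    exact st_eta v
  refine ⟨{ toEquiv := hinv.toPerm _, map_rel_iff' := ?_ }, fun v => rfl⟩
  intro u v
  rw [Function.Involutive.coe_toPerm, deleteEdges_incidenceSet_adj, rung_adj_fromRel]
  simp only [deleteEdges_incidenceSet_adj, rung_adj_iff, Set.mem_setOf_eq, ne_eq, rung_eq_st_iff, st_zero,
    st_one, Nat.cast_add, Nat.cast_one, Nat.cast_ofNat]
  omega

/-- The rung of the right block minus `c`, at its first column `k+2`, is the end rung of `R_m`.
[folklore] -/
private theorem rung_rightBlock_kernel (k m : ℕ) (x : ℝ) :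
    pathKernel (Del[Blk[Del[Lad[k + m + 2], st (k + 1 : ℕ) 0], Bset[k]], st (k + 1 : ℕ) 1]) x
        (st ((k : ℤ) + 2) 1) (st ((k : ℤ) + 2) 0) =
      pathKernel (Lad[m]) x (st m 1) (st m 0) := by
  obtain ⟨ψ, hψ⟩ := rung_rightBlock_iso k m
  have h1 : ψ (st ((k : ℤ) + 2) 1) = st m 1 := by
    rw [hψ, rung_eq_st_iff, st_zero, st_one, st_zero, st_one]; exact ⟨by omega, rfl⟩
  have h0 : ψ (st ((k : ℤ) + 2) 0) = st m 0 := by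
    rw [hψ, rung_eq_st_iff, st_zero, st_one, st_zero, st_one]; exact ⟨by omega, rfl⟩
  rw [← h0, ← h1, pathKernel_map_iso ψ x]

/-- **Interior rungs, reduced to end rungs.** For the column `k+1` of `R_{k+m+2}`:
`Z((k+1,0),(k+1,1)) = x (x Z_{R_k}((k,0),(k,1)) + 1 + x Z_{R_m}((m,0),(m,1)))`. [folklore] -/
private theorem rung_interior (k m : ℕ) {x : ℝ} (hx : 0 ≤ x) :
    pathKernel (Lad[k + m + 2]) x (st (k + 1 : ℕ) 0) (st (k + 1 : ℕ) 1) =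
      ENNReal.ofReal x * (ENNReal.ofReal x * pathKernel (Lad[k]) x (st k 0) (st k 1) + 1 +
        ENNReal.ofReal x * pathKernel (Lad[m]) x (st m 0) (st m 1)) := by
  classical
  have hab : st (k + 1 : ℕ) 0 ≠ st (k + 1 : ℕ) 1 := by
    rw [ne_eq, rung_eq_st_iff, st_zero, st_one]; omega
  have h₁₂ : st (k : ℤ) 0 ≠ st (k + 1 : ℕ) 1 := by
    rw [ne_eq, rung_eq_st_iff, st_zero, st_one]; omega
  have h₁₃ : st (k : ℤ) 0 ≠ st ((k : ℤ) + 2) 0 := by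
    rw [ne_eq, rung_eq_st_iff, st_zero, st_one]; omega
  have h₂₃ : st (k + 1 : ℕ) 1 ≠ st ((k : ℤ) + 2) 0 := by
    rw [ne_eq, rung_eq_st_iff, st_zero, st_one]; omega
  rw [rung_firstStep_triple _ x hx hab h₁₂ h₁₃ h₂₃ (rung_mid_neighborSet k m), pathKernel_self]
  -- the cut `Aset[k] ∩ Bset[k] = {c}` of `R' = R_{k+m+2} - (k+1,0)`
  have hAB : ∀ v : Site 2, v ∈ Aset[k] ∨ v ∈ Bset[k] := fun v => by
    simp only [Set.mem_setOf_eq]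
    by_cases h : v 0 ≤ (k : ℤ)
    · exact Or.inl (Or.inl h)
    · exact Or.inr (by omega)
  have hc : ∀ v : Site 2, v ∈ Aset[k] → v ∈ Bset[k] → v = st (k + 1 : ℕ) 1 := by
    intro v hvA hvB
    simp only [Set.mem_setOf_eq] at hvA hvB
    exact hvA.resolve_left (by omega)
  have hcA : st (k + 1 : ℕ) 1 ∈ Aset[k] := Or.inr rfl
  have hcB : st (k + 1 : ℕ) 1 ∈ Bset[k] := by
    rw [Set.mem_setOf_eq, st_zero]; omega
  have haA : st (k : ℤ) 0 ∈ Aset[k] := Or.inl (by rw [st_zero])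
  have hrB : st ((k : ℤ) + 2) 0 ∈ Bset[k] := by
    rw [Set.mem_setOf_eq, st_zero]; omega
  have hsep : ∀ u v : Site 2, (Del[Lad[k + m + 2], st (k + 1 : ℕ) 0]).Adj u v →
      u ∈ Aset[k] ∧ v ∈ Aset[k] ∨ u ∈ Bset[k] ∧ v ∈ Bset[k] := fun u v h => by
    simp only [deleteEdges_incidenceSet_adj, rung_adj_iff, ne_eq, rung_eq_st_iff, Nat.cast_add,
      Nat.cast_one, Nat.cast_ofNat] at h
    simp only [Set.mem_setOf_eq, rung_eq_st_iff, Nat.cast_add, Nat.cast_one]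
    omega
  -- left term: cut at `c`, then the leaf `c` of the left block, leaving the end rung of `R_k`
  rw [stub_cutVertex_factor _ x hx _ _ _ _ _ hAB hc hcA hcB hsep haA hcB, pathKernel_self, mul_one,
    pathKernel_comm _ x (st (k : ℤ) 0) (st (k + 1 : ℕ) 1),
    pathKernel_firstStep_single _ x hx h₁₂.symm (rung_leftBlock_neighborSet k m),
    rung_leftBlock_delete k m, pathKernel_comm _ x (st (k : ℤ) 1) (st (k : ℤ) 0)]
  -- right term: cut at `c` (blocks exchanged), the leaf `c` of the right block, reflection onto `R_m`
  rw [stub_cutVertex_factor _ x hx _ _ _ _ _ (fun v => (hAB v).symm) (fun v hB hA => hc v hA hB) hcB hcA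
      (fun u v h => (hsep u v h).symm) hrB hcA, pathKernel_self, mul_one,
    pathKernel_comm _ x (st ((k : ℤ) + 2) 0) (st (k + 1 : ℕ) 1),
    pathKernel_firstStep_single _ x hx h₂₃ (rung_rightBlock_neighborSet k m),
    rung_rightBlock_kernel k m x, pathKernel_comm _ x (st (m : ℤ) 1) (st (m : ℤ) 0)]

/-! ## The stub -/

/-- **Tool stub `stub_ladderRung`.** The rung kernel of the ladder `{0..L}×{0,1}` at column `i ≤ L`,
`x ≥ 0`: `Z((i,0),(i,1)) = x + E_i + E_{L-i}` with `E_k = Σ_{d<k} x^{2d+3}` — the rung itself, or a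
U-turn excursion of depth `d+1` to the left (`2(d+1)` horizontal steps and one rung) or to the right.
[folklore] -/
theorem stub_ladderRung (L i : ℕ) (hiL : i ≤ L) {x : ℝ} (hx : 0 ≤ x) :
    pathKernel (discreteDomainGraph (rectDomain L 1) 1) x (st i 0) (st i 1) =
      ENNReal.ofReal (x + (∑ d ∈ Finset.range i, x ^ (2 * d + 3)) +
        ∑ d ∈ Finset.range (L - i), x ^ (2 * d + 3)) := by
  have hE : ∀ n, 0 ≤ ∑ d ∈ Finset.range n, x ^ (2 * d + 3) := fun n =>
    Finset.sum_nonneg fun d _ => pow_nonneg hx _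
  rcases Nat.eq_zero_or_pos i with rfl | hi0
  · -- first rung: reflect onto the end rung
    rw [Nat.cast_zero, Nat.sub_zero, Finset.sum_range_zero, add_zero, rung_start L x, rung_end L hx]
  rcases hiL.eq_or_lt with rfl | hlt
  · -- end rung
    rw [Nat.sub_self, Finset.sum_range_zero, add_zero, rung_end i hx]
  -- interior rung
  obtain ⟨k, rfl⟩ : ∃ k, i = k + 1 := Nat.exists_eq_succ_of_ne_zero hi0.ne'
  obtain ⟨m, rfl⟩ : ∃ m, L = k + m + 2 := ⟨L - k - 2, by omega⟩
  rw [rung_interior k m hx, rung_end k hx, rung_end m hx,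
    show k + m + 2 - (k + 1) = m + 1 by omega, rung_sum_succ x k, rung_sum_succ x m,
    ← ENNReal.ofReal_mul hx, ← ENNReal.ofReal_mul hx, ← ENNReal.ofReal_one,
    ← ENNReal.ofReal_add (mul_nonneg hx (add_nonneg hx (hE k))) zero_le_one,
    ← ENNReal.ofReal_add (add_nonneg (mul_nonneg hx (add_nonneg hx (hE k))) zero_le_one)
      (mul_nonneg hx (add_nonneg hx (hE m))), ← ENNReal.ofReal_mul hx]
  congr 1
  ring

end Summit.CriticalPhenomena.SAWScalingLimit.Theorems.BoundaryTP2
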